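import Mathlib
import HarnessLib
import Summits.MatrixMultiplication.MatrixMultiplication.Theses.OutsiderSandwich
import Summits.MatrixMultiplication.MatrixMultiplication.Theorems.OutsiderSandwichLaserFloorTop

/-!
# OutsiderSandwich — the LASER CLASS is decided, I-a: block values, counting, additivity
(decomp-mm lens 4 «minimal counterexample / extremal reduction», gen 12; part I-b
`OutsiderSandwichLaserClass.lean` assembles these into the capacity theorem, part II
`OutsiderSandwichLaserClassRates.lean` into the rates and the attainment)

Lens 4 asks WHERE a counterexample to the residual law of the cut of record
(`closes : LaserTangency → LaserMergeOptimal → SummitIffLaserTangency → ω = 2`, rev 15; residual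
BOTTOM = `LaserMergeOptimal` 27897) could live.  Parts I-a/I-b prove that it cannot live in the LASER
CLASS.  A LASER DATUM of extent `N` is a block-diagonal sum `D = ⊕ᵢ ⟨2^{xᵢ}, 2^{yᵢ}, 2^{zᵢ}⟩` (tree
`matMulDirectSum`) of FINE BLOCKS of `cw₂^{⊠N}` (`xᵢ + yᵢ + zᵢ = N`) with at most `C(N, min t)` blocks
of each type `t = (a,b,c)` — the shape of everything a laser-method zeroing-out of
`cw₂^{⊠N} = Σ_types (fine blocks)` retains (independent fine blocks; a type cannot occur more often
than there are index blocks on its scarcest side).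

* §1 BLOCK VALUES: for a universal spectral point `F` with side values
  `(x,y,z) = (F⟨2,1,1⟩, F⟨1,2,1⟩, F⟨1,1,2⟩)`: `F⟨2^a,2^b,2^c⟩ = x^a y^b z^c`, `xyz = 2^{τ_F}`
  (`τ_F = log₂ F⟨2,2,2⟩`, the matrix exponent of `F`), `1 ≤ x,y,z ≤ 2`, hence
  `F⟨2^a,2^b,2^c⟩ ≤ 2^{a+b+c−3k}·2^{kτ_F}` for `k ≤ min(a,b,c)` (`map_block_le`).
* §2 COUNTING: `C(N,k)·2^{N−k} ≤ 3^N` (one term of `(1+2)^N`), so per type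
  `C(N,min t)·F(block_t) ≤ 3^N·2^{((τ_F−2)/3)N}` (`type_bound`).
* §3a ADDITIVITY `F(⊕ᵢ⟨kᵢ,mᵢ,nᵢ⟩) = Σᵢ F⟨kᵢ,mᵢ,nᵢ⟩` over `ℂ` (`map_matMulDirectSum_eq_sum`; peeling a
  block is a relabelling in both directions).  The tree's `StrictAsymptoticSumInequality` has the
  `≤` half over any field but is not built on the farm at present, hence the re-proof.

Sources: CoppersmithWinograd1990 (§§6–7); BurgisserClausenShokrollahi1997 (Thm. 15.41, §15.7–15.8);
Strassen1988; Strassen1991; ChristandlVranaZuiddam2023 (§2, universal spectral points); Blaser2013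
(§§5–7).
-/

set_option linter.dupNamespace false

namespace Summit.MatrixMultiplication.MatrixMultiplication.Theorems.OutsiderSandwichLaserClassBlocks

open scoped BigOperators
open Finset Filter
open Literature.Computability.AlgebraicComplexity
open Literature.Barriers.MatrixMultiplication (IsAdequate)
open Summit.MatrixMultiplication.MatrixMultiplication.Theorems.OutsiderSandwichLaserFloor
  (isAdequate_of_universal map_matMulTensor_one one_le_map_matMulTensor
    rpow_matExp_le_map_matMulTensor two_le_matExp)
open Summit.MatrixMultiplication.MatrixMultiplication.Theorems.OutsiderSandwichLaserFloorTop
  (exists_top_point)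

variable {F : SpectralMap ℂ}

/-! ## 1. A universal spectral point on the fine blocks `⟨2^a, 2^b, 2^c⟩` -/

/-- `F(⟨2^a,1,1⟩) = F(⟨2,1,1⟩)^a`. -/
theorem map_matMulTensor_pow₁ (hF : IsUniversalSpectralPoint ℂ F) (a : ℕ) :
    F (matMulTensor ℂ (2 ^ a) 1 1) = F (matMulTensor ℂ 2 1 1) ^ a := by
  have hA := isAdequate_of_universal hF
  induction a with
  | zero =>
    rw [SpectralMap.map_matMulTensor_congr F (pow_zero 2) rfl rfl, pow_zero]
    exact map_matMulTensor_one hF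
  | succ a ih =>
    have h := hA.mamu (2 ^ a) 2 1 1 1 1 Nat.one_le_two_pow (by norm_num) le_rfl le_rfl le_rfl le_rfl
    rw [SpectralMap.map_matMulTensor_congr F (pow_succ 2 a).symm (Nat.mul_one 1) (Nat.mul_one 1)]
      at h
    rw [h, ih, pow_succ]

/-- `F(⟨1,2^b,1⟩) = F(⟨1,2,1⟩)^b`. -/
theorem map_matMulTensor_pow₂ (hF : IsUniversalSpectralPoint ℂ F) (b : ℕ) :
    F (matMulTensor ℂ 1 (2 ^ b) 1) = F (matMulTensor ℂ 1 2 1) ^ b := by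
  have hA := isAdequate_of_universal hF
  induction b with
  | zero =>
    rw [SpectralMap.map_matMulTensor_congr F rfl (pow_zero 2) rfl, pow_zero]
    exact map_matMulTensor_one hF
  | succ b ih =>
    have h := hA.mamu 1 1 (2 ^ b) 2 1 1 le_rfl le_rfl Nat.one_le_two_pow (by norm_num) le_rfl le_rfl
    rw [SpectralMap.map_matMulTensor_congr F (Nat.mul_one 1) (pow_succ 2 b).symm (Nat.mul_one 1)]
      at h
    rw [h, ih, pow_succ]

/-- `F(⟨1,1,2^c⟩) = F(⟨1,1,2⟩)^c`. -/
theorem map_matMulTensor_pow₃ (hF : IsUniversalSpectralPoint ℂ F) (c : ℕ) :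
    F (matMulTensor ℂ 1 1 (2 ^ c)) = F (matMulTensor ℂ 1 1 2) ^ c := by
  have hA := isAdequate_of_universal hF
  induction c with
  | zero =>
    rw [SpectralMap.map_matMulTensor_congr F rfl rfl (pow_zero 2), pow_zero]
    exact map_matMulTensor_one hF
  | succ c ih =>
    have h := hA.mamu 1 1 1 1 (2 ^ c) 2 le_rfl le_rfl le_rfl le_rfl Nat.one_le_two_pow (by norm_num)
    rw [SpectralMap.map_matMulTensor_congr F (Nat.mul_one 1) (Nat.mul_one 1) (pow_succ 2 c).symm]
      at h
    rw [h, ih, pow_succ]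

/-- **Block values**: `F(⟨2^a,2^b,2^c⟩) = x^a · y^b · z^c` with the SIDE VALUES
`(x, y, z) = (F⟨2,1,1⟩, F⟨1,2,1⟩, F⟨1,1,2⟩)` of `F`. -/
theorem map_block (hF : IsUniversalSpectralPoint ℂ F) (a b c : ℕ) :
    F (matMulTensor ℂ (2 ^ a) (2 ^ b) (2 ^ c)) =
      F (matMulTensor ℂ 2 1 1) ^ a * F (matMulTensor ℂ 1 2 1) ^ b * F (matMulTensor ℂ 1 1 2) ^ c := by
  rw [(isAdequate_of_universal hF).map_matMul_eq_mul₃ Nat.one_le_two_pow Nat.one_le_two_pow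
    Nat.one_le_two_pow, map_matMulTensor_pow₁ hF, map_matMulTensor_pow₂ hF, map_matMulTensor_pow₃ hF]

/-- The three side values multiply to `F(⟨2,2,2⟩) = 2^{τ_F}`. -/
theorem side_mul (hF : IsUniversalSpectralPoint ℂ F) :
    F (matMulTensor ℂ 2 1 1) * F (matMulTensor ℂ 1 2 1) * F (matMulTensor ℂ 1 1 2) =
      F (matMulTensor ℂ 2 2 2) :=
  ((isAdequate_of_universal hF).map_matMul_eq_mul₃ (by norm_num) (by norm_num) (by norm_num)).symm

/-- Each side value is at most `2` (`F ≤ R`, `R(⟨2,1,1⟩) ≤ 2`). -/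
theorem side_le_two (hF : IsUniversalSpectralPoint ℂ F) :
    F (matMulTensor ℂ 2 1 1) ≤ 2 ∧ F (matMulTensor ℂ 1 2 1) ≤ 2 ∧ F (matMulTensor ℂ 1 1 2) ≤ 2 := by
  have h₁ : tensorRank (matMulTensor ℂ 2 1 1) ≤ 2 := by simpa using tensorRank_matMulTensor_le ℂ 2 1 1
  have h₂ : tensorRank (matMulTensor ℂ 1 2 1) ≤ 2 := by simpa using tensorRank_matMulTensor_le ℂ 1 2 1
  have h₃ : tensorRank (matMulTensor ℂ 1 1 2) ≤ 2 := by simpa using tensorRank_matMulTensor_le ℂ 1 1 2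
  exact ⟨(hF.le_tensorRank _).trans (by exact_mod_cast h₁),
    (hF.le_tensorRank _).trans (by exact_mod_cast h₂), (hF.le_tensorRank _).trans (by exact_mod_cast h₃)⟩

/-- Each side value is at least `1`. -/
theorem one_le_side (hF : IsUniversalSpectralPoint ℂ F) :
    1 ≤ F (matMulTensor ℂ 2 1 1) ∧ 1 ≤ F (matMulTensor ℂ 1 2 1) ∧ 1 ≤ F (matMulTensor ℂ 1 1 2) := by
  have hA := isAdequate_of_universal hF
  have h1 := map_matMulTensor_one hF
  exact ⟨hA.one_le_map_matMul h1 (by norm_num) le_rfl le_rfl,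
    hA.one_le_map_matMul h1 le_rfl (by norm_num) le_rfl, hA.one_le_map_matMul h1 le_rfl le_rfl (by norm_num)⟩

/-- **Block bound.**  If `k ≤ a, b, c` then
`F(⟨2^a,2^b,2^c⟩) ≤ 2^{a+b+c−3k} · 2^{k·τ_F}` (`x^a y^b z^c = (xyz)^k · x^{a−k} y^{b−k} z^{c−k}`,
`xyz = 2^{τ_F}`, `x, y, z ≤ 2`). -/
theorem map_block_le (hF : IsUniversalSpectralPoint ℂ F) {a b c k : ℕ} (hka : k ≤ a) (hkb : k ≤ b)
    (hkc : k ≤ c) :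
    F (matMulTensor ℂ (2 ^ a) (2 ^ b) (2 ^ c)) ≤
      (2 : ℝ) ^ (a + b + c - 3 * k) *
        (2 : ℝ) ^ (Real.logb 2 (F (matMulTensor ℂ 2 2 2)) * k) := by
  set x := F (matMulTensor ℂ 2 1 1) with hx
  set y := F (matMulTensor ℂ 1 2 1) with hy
  set z := F (matMulTensor ℂ 1 1 2) with hz
  obtain ⟨hx2, hy2, hz2⟩ := side_le_two hF
  obtain ⟨hx1, hy1, hz1⟩ := one_le_side hF
  have hx0 : 0 ≤ x := zero_le_one.trans hx1
  have hy0 : 0 ≤ y := zero_le_one.trans hy1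
  have hz0 : 0 ≤ z := zero_le_one.trans hz1
  have hT0 : 0 < F (matMulTensor ℂ 2 2 2) :=
    lt_of_lt_of_le one_pos (one_le_map_matMulTensor hF (by norm_num))
  have hτ : (2 : ℝ) ^ (Real.logb 2 (F (matMulTensor ℂ 2 2 2)) * k) = (x * y * z) ^ k := by
    rw [Real.rpow_mul_natCast (by norm_num), Real.rpow_logb two_pos (by norm_num) hT0, side_mul hF]
  rw [map_block hF, hτ]
  have e : x ^ a * y ^ b * z ^ c =
      (x ^ (a - k) * y ^ (b - k) * z ^ (c - k)) * (x * y * z) ^ k := by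
    rw [show a = (a - k) + k by omega, show b = (b - k) + k by omega, show c = (c - k) + k by omega,
      pow_add, pow_add, pow_add]
    simp only [Nat.add_sub_cancel]
    ring
  rw [e]
  refine mul_le_mul_of_nonneg_right ?_ (pow_nonneg (by positivity) k)
  calc x ^ (a - k) * y ^ (b - k) * z ^ (c - k)
      ≤ (2 : ℝ) ^ (a - k) * (2 : ℝ) ^ (b - k) * (2 : ℝ) ^ (c - k) :=
        mul_le_mul (mul_le_mul (pow_le_pow_left₀ hx0 hx2 _) (pow_le_pow_left₀ hy0 hy2 _)
          (pow_nonneg hy0 _) (pow_nonneg (by norm_num) _)) (pow_le_pow_left₀ hz0 hz2 _)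
          (pow_nonneg hz0 _) (by positivity)
    _ = (2 : ℝ) ^ (a + b + c - 3 * k) := by
        rw [← pow_add, ← pow_add]; congr 1; omega

/-! ## 2. Counting: `C(N,k) · 2^{N−k} ≤ 3^N` and the per-type bound -/

/-- One term of `(1 + 2)^N = ∑ₖ C(N,k) 2^{N−k}`. -/
theorem choose_mul_two_pow_le (N k : ℕ) (hk : k ≤ N) : N.choose k * 2 ^ (N - k) ≤ 3 ^ N := by
  have h := add_pow (1 : ℕ) 2 N
  norm_num at h
  have hmem : k ∈ range (N + 1) := mem_range.2 (Nat.lt_succ_of_le hk)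
  have hle := single_le_sum (f := fun m => 2 ^ (N - m) * N.choose m) (fun m _ => Nat.zero_le _) hmem
  calc N.choose k * 2 ^ (N - k) = 2 ^ (N - k) * N.choose k := mul_comm _ _
    _ ≤ ∑ m ∈ range (N + 1), 2 ^ (N - m) * N.choose m := hle
    _ = 3 ^ N := by rw [h]

/-- **Per-type bound.**  For a type `(a,b,c)` with `a+b+c = N` and `k = min(a,b,c)`:
`C(N,k) · F(⟨2^a,2^b,2^c⟩) ≤ 3^N · 2^{((τ_F − 2)/3)·N}` (uses `2 ≤ τ_F`, `3k ≤ N`). -/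
theorem type_bound (hF : IsUniversalSpectralPoint ℂ F) {a b c N : ℕ} (hN : a + b + c = N) :
    (N.choose (min a (min b c)) : ℝ) * F (matMulTensor ℂ (2 ^ a) (2 ^ b) (2 ^ c)) ≤
      (3 : ℝ) ^ N * (2 : ℝ) ^ ((Real.logb 2 (F (matMulTensor ℂ 2 2 2)) - 2) / 3 * N) := by
  set τ := Real.logb 2 (F (matMulTensor ℂ 2 2 2)) with hτdef
  set k := min a (min b c) with hkdef
  have hka : k ≤ a := min_le_left _ _
  have hkb : k ≤ b := (min_le_right _ _).trans (min_le_left _ _)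
  have hkc : k ≤ c := (min_le_right _ _).trans (min_le_right _ _)
  have h3k : 3 * k ≤ N := by omega
  have hkN : k ≤ N := by omega
  have hτ2 : 2 ≤ τ := two_le_matExp hF
  have hblk := map_block_le hF hka hkb hkc
  rw [hN] at hblk
  -- `C(N,k) 2^{N-3k} 2^{τ k} = [C(N,k) 2^{N-k}] 2^{(τ-2)k} ≤ 3^N 2^{(τ-2)k}`
  have hcount : (N.choose k : ℝ) * (2 : ℝ) ^ (N - k) ≤ (3 : ℝ) ^ N := by
    exact_mod_cast choose_mul_two_pow_le N k hkN
  have hsplit : (2 : ℝ) ^ (τ * k) = (2 : ℝ) ^ (2 * k) * (2 : ℝ) ^ ((τ - 2) * k) := by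
    rw [← Real.rpow_natCast (2 : ℝ) (2 * k), ← Real.rpow_add two_pos]
    congr 1; push_cast; ring
  have hpow : (2 : ℝ) ^ (N - 3 * k) * (2 : ℝ) ^ (2 * k) = (2 : ℝ) ^ (N - k) := by
    rw [← pow_add]; congr 1; omega
  have hexp : (2 : ℝ) ^ ((τ - 2) * k) ≤ (2 : ℝ) ^ ((τ - 2) / 3 * N) := by
    refine Real.rpow_le_rpow_of_exponent_le one_le_two ?_
    have hk3 : (k : ℝ) * 3 ≤ N := by exact_mod_cast (by omega : k * 3 ≤ N)
    have : (τ - 2) * k ≤ (τ - 2) * (N / 3) :=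
      mul_le_mul_of_nonneg_left (by linarith) (by linarith)
    linarith [this]
  calc (N.choose k : ℝ) * F (matMulTensor ℂ (2 ^ a) (2 ^ b) (2 ^ c))
      ≤ (N.choose k : ℝ) * ((2 : ℝ) ^ (N - 3 * k) * (2 : ℝ) ^ (τ * k)) :=
        mul_le_mul_of_nonneg_left hblk (Nat.cast_nonneg _)
    _ = ((N.choose k : ℝ) * (2 : ℝ) ^ (N - k)) * (2 : ℝ) ^ ((τ - 2) * k) := by
        rw [hsplit, ← hpow]; ring
    _ ≤ (3 : ℝ) ^ N * (2 : ℝ) ^ ((τ - 2) * k) :=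
        mul_le_mul_of_nonneg_right hcount (by positivity)
    _ ≤ (3 : ℝ) ^ N * (2 : ℝ) ^ ((τ - 2) / 3 * N) :=
        mul_le_mul_of_nonneg_left hexp (by positivity)

/-! ## 3a. Additivity of a universal point over block-diagonal sums (at `K = ℂ`)

The tree's `StrictAsymptoticSumInequality` proves `F(⊕ᵢ⟨kᵢ,mᵢ,nᵢ⟩) ≤ Σᵢ F(⟨kᵢ,mᵢ,nᵢ⟩)` over any
field; that module is not built on the farm at present, so the `ℂ` case is re-proved here — with
EQUALITY, by relabelling in both directions. -/

/-- Peeling off block `0` is a relabelling of the index types in BOTH directions: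
`⊕_{i<q+1} ⟨kᵢ,mᵢ,nᵢ⟩` and `⟨k₀,m₀,n₀⟩ ⊕ (⊕_{i<q} ⟨k_{i+1},m_{i+1},n_{i+1}⟩)` restrict to each other.
[cite: Blaser2013, §7] -/
theorem matMulDirectSum_succ_restrictsTo {q : ℕ} (k m n : Fin (q + 1) → ℕ) :
    TensorRestrictsTo (directSumTensor (matMulTensor ℂ (k 0) (m 0) (n 0))
        (matMulDirectSum ℂ (fun i => k i.succ) (fun i => m i.succ) (fun i => n i.succ)))
      (matMulDirectSum ℂ k m n) ∧
    TensorRestrictsTo (matMulDirectSum ℂ k m n)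
      (directSumTensor (matMulTensor ℂ (k 0) (m 0) (n 0))
        (matMulDirectSum ℂ (fun i => k i.succ) (fun i => m i.succ) (fun i => n i.succ))) := by
  classical
  constructor
  · -- forward relabelling `Σ_{i<q+1} → (block 0) ⊕ Σ_{i<q}`, by cases on the block index
    let fZ : (Σ i : Fin (q + 1), Fin (k i) × Fin (n i)) →
        (Fin (k 0) × Fin (n 0)) ⊕ (Σ i : Fin q, Fin (k i.succ) × Fin (n i.succ)) :=
      fun a => Fin.cases (motive := fun i => Fin (k i) × Fin (n i) → _) (fun pr => Sum.inl pr)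
        (fun j pr => Sum.inr ⟨j, pr⟩) a.1 a.2
    let fX : (Σ i : Fin (q + 1), Fin (k i) × Fin (m i)) →
        (Fin (k 0) × Fin (m 0)) ⊕ (Σ i : Fin q, Fin (k i.succ) × Fin (m i.succ)) :=
      fun a => Fin.cases (motive := fun i => Fin (k i) × Fin (m i) → _) (fun pr => Sum.inl pr)
        (fun j pr => Sum.inr ⟨j, pr⟩) a.1 a.2
    let fY : (Σ i : Fin (q + 1), Fin (m i) × Fin (n i)) →
        (Fin (m 0) × Fin (n 0)) ⊕ (Σ i : Fin q, Fin (m i.succ) × Fin (n i.succ)) :=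
      fun a => Fin.cases (motive := fun i => Fin (m i) × Fin (n i) → _) (fun pr => Sum.inl pr)
        (fun j pr => Sum.inr ⟨j, pr⟩) a.1 a.2
    have key : matMulDirectSum ℂ k m n = fun a b c =>
        directSumTensor (matMulTensor ℂ (k 0) (m 0) (n 0))
          (matMulDirectSum ℂ (fun i => k i.succ) (fun i => m i.succ) (fun i => n i.succ))
          (fZ a) (fX b) (fY c) := by
      funext a b c
      obtain ⟨i, pa⟩ := a
      obtain ⟨i', pb⟩ := b
      obtain ⟨i'', pc⟩ := c
      refine Fin.cases ?_ (fun j => ?_) i pa <;> refine Fin.cases ?_ (fun j' => ?_) i' pb <;>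
        refine Fin.cases ?_ (fun j'' => ?_) i'' pc <;> intro pc pb pa
      · simp [fZ, fX, fY, matMulDirectSum, matMulTensor, directSumTensor, Fin.ext_iff]
      · simp [fZ, fX, fY, matMulDirectSum, directSumTensor, (Fin.succ_ne_zero j'').symm]
      · simp [fZ, fX, fY, matMulDirectSum, directSumTensor, (Fin.succ_ne_zero j').symm]
      · simp [fZ, fX, fY, matMulDirectSum, directSumTensor, (Fin.succ_ne_zero j').symm]
      · simp [fZ, fX, fY, matMulDirectSum, directSumTensor, Fin.succ_ne_zero j]
      · simp [fZ, fX, fY, matMulDirectSum, directSumTensor, Fin.succ_ne_zero j]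
      · simp [fZ, fX, fY, matMulDirectSum, directSumTensor]
      · simp [fZ, fX, fY, matMulDirectSum, directSumTensor, Fin.succ_inj]
    rw [key]
    exact tensorRestrictsTo_precomp _ _ _ _
  · -- backward relabelling `(block 0) ⊕ Σ_{i<q} → Σ_{i<q+1}`
    let gZ : (Fin (k 0) × Fin (n 0)) ⊕ (Σ i : Fin q, Fin (k i.succ) × Fin (n i.succ)) →
        (Σ i : Fin (q + 1), Fin (k i) × Fin (n i)) :=
      Sum.elim (fun pr => ⟨0, pr⟩) (fun a => ⟨a.1.succ, a.2⟩)
    let gX : (Fin (k 0) × Fin (m 0)) ⊕ (Σ i : Fin q, Fin (k i.succ) × Fin (m i.succ)) →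
        (Σ i : Fin (q + 1), Fin (k i) × Fin (m i)) :=
      Sum.elim (fun pr => ⟨0, pr⟩) (fun a => ⟨a.1.succ, a.2⟩)
    let gY : (Fin (m 0) × Fin (n 0)) ⊕ (Σ i : Fin q, Fin (m i.succ) × Fin (n i.succ)) →
        (Σ i : Fin (q + 1), Fin (m i) × Fin (n i)) :=
      Sum.elim (fun pr => ⟨0, pr⟩) (fun a => ⟨a.1.succ, a.2⟩)
    have key : directSumTensor (matMulTensor ℂ (k 0) (m 0) (n 0))
          (matMulDirectSum ℂ (fun i => k i.succ) (fun i => m i.succ) (fun i => n i.succ)) =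
        fun u v w => matMulDirectSum ℂ k m n (gZ u) (gX v) (gY w) := by
      funext u v w
      rcases u with pa | ⟨j, pa⟩ <;> rcases v with pb | ⟨j', pb⟩ <;> rcases w with pc | ⟨j'', pc⟩
      · simp [gZ, gX, gY, matMulDirectSum, matMulTensor, directSumTensor, Fin.ext_iff]
      · simp [gZ, gX, gY, matMulDirectSum, directSumTensor, (Fin.succ_ne_zero j'').symm]
      · simp [gZ, gX, gY, matMulDirectSum, directSumTensor, (Fin.succ_ne_zero j').symm]
      · simp [gZ, gX, gY, matMulDirectSum, directSumTensor, (Fin.succ_ne_zero j').symm]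
      · simp [gZ, gX, gY, matMulDirectSum, directSumTensor, Fin.succ_ne_zero j]
      · simp [gZ, gX, gY, matMulDirectSum, directSumTensor, Fin.succ_ne_zero j]
      · simp [gZ, gX, gY, matMulDirectSum, directSumTensor, Fin.succ_ne_zero j']
      · simp [gZ, gX, gY, matMulDirectSum, directSumTensor, Fin.succ_inj]
    rw [key]
    exact tensorRestrictsTo_precomp _ _ _ _

/-- **Additivity over block-diagonal sums**: `F(⊕ᵢ ⟨kᵢ,mᵢ,nᵢ⟩) = Σᵢ F(⟨kᵢ,mᵢ,nᵢ⟩)` for every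
universal spectral point over `ℂ`. [cite: ChristandlVranaZuiddam2023, §1.2] -/
theorem map_matMulDirectSum_eq_sum (hF : IsUniversalSpectralPoint ℂ F) :
    ∀ {q : ℕ} (k m n : Fin q → ℕ),
      F (matMulDirectSum ℂ k m n) = ∑ i, F (matMulTensor ℂ (k i) (m i) (n i)) := by
  intro q
  induction q with
  | zero =>
    intro k m n
    have h0 : matMulDirectSum ℂ k m n = 0 := by
      funext a; exact (IsEmpty.false a.1).elim
    rw [h0, hF.map_zero]
    simp
  | succ q ih =>
    intro k m n
    obtain ⟨h₁, h₂⟩ := matMulDirectSum_succ_restrictsTo k m n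
    rw [le_antisymm (hF.mono _ _ h₁) (hF.mono _ _ h₂), hF.map_directSum, ih,
      Fin.sum_univ_succ fun i => F (matMulTensor ℂ (k i) (m i) (n i))]

end Summit.MatrixMultiplication.MatrixMultiplication.Theorems.OutsiderSandwichLaserClassBlocks
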